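import Literature.Geometry.Kaehler.ComplexTorusHodge
import Literature.Geometry.Kaehler.ComplexTorusZuckerJ
import Literature.NumberTheory.Transcendental.DeRhamTheorem
import HarnessLib

/-!
# Zucker's `J`-tori (the Kähler counterexamples to the analytic Hodge conjecture): the data

S. Zucker, *The Hodge conjecture for cubic fourfolds*, Compositio Math. 34 (1977), Appendix B
("Complex tori with non-analytic rational cohomology of type `(p, p)`"), for `n = 1`:
`V = ℂ ⊕ ℂ` with coordinates `(z, w)`, `J(z, w) = (iz, -iw)`, a lattice `L` with `JL = L` and
basis `{v₁, v₂, Jv₁, Jv₂}`, the **`J`-torus** `T = V/L` with its automorphism `J`, and Mumford's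
lemma: for `ω = a dz ∧ dw̄` (a suitable `a`), `ξ = Re ω`, `η = Im ω` are *integral* classes of
type `(1, 1)` with `J^* ω = -ω`. This file realises this data on the tree's complex tori
(`ComplexTorus`), in the normalisation `v₁ = (1, 1)`, `v₂ = (a, ā + 1)` (one complex parameter
`a`; every `J`-torus with `v₁, v₂` in general position is isomorphic to one of these after
rescaling the two coordinates, which commutes with `J`), for which `a_Mumford = 1`:

* `Zucker.phi a : (Fin (2 * 2) → ℝ) ≃L[ℝ] (Fin 2 → ℂ)`, the period isomorphism of the lattice
  basis `(v₁, Jv₁, v₂, Jv₂)`: `x ↦ (u + a v, ū + (ā + 1) v̄)`, `u = x₀ + i x₁`, `v = x₂ + i x₃`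
  (`phi_apply_zero/one`), and `Zucker.Torus a := ComplexTorus (phi a)` — a compact Kähler
  surface homeomorphic to `(S¹)⁴` with all the instances of the Kähler package (inherited);
* for the operator `Zucker.J (z, w) = (iz, -iw)` and the form `Zucker.omega = dz ∧ dw̄` of
  `ComplexTorusZuckerJ.lean` (reused, not redefined): the integer matrix
  `Zucker.A` of `J` in the lattice basis (`phi_mulVec_A : Φ (A x) = J (Φ x)`, i.e. `JL = L`), so
  that `J` **is a holomorphic automorphism of the torus**, `Zucker.JT a = mapMatrix A`
  (`contMDiff_JT`), with real analytic representation `J` (`realRep_A`);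
* for `ω = Zucker.omega`: the evaluation formula `omega_apply`, type `(1, 1)` (`isConstOfType_omega`),
  `J^* ω = -ω` (`omega_comp_J`) and **periods on the lattice basis in `{0, 1, i, -1}`**
  (`omega_phi_basis`: Mumford's lemma, "the numbers obtained are all of the form `iᵏ` or `0`"),
  hence the classes `Zucker.omegaClass a = [constForm ω] ∈ H^{1,1}(T) ⊆ H²_dR(T; ℂ)`
  (`omegaClass_mem_hodgePQ`) with `J^*[ω] = -[ω]` (`map_JT_omegaClass`).

## Not here

Zucker's Proposition (for general `a` the rational `(1,1)`-classes are exactly `ℚξ ⊕ ℚη`) and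
Theorem (no analytic curves); the comparison with singular cohomology.

## References

* S. Zucker, Compositio Math. 34 (1977), Appendix B, pp. 206–208 (Lemma (Mumford),
  Proposition, Theorem). [Zucker1977]
* C. Voisin, IMRN 2002, no. 20, §1. [Voisin2002KaehlerCounterexample]
-/

noncomputable section

open scoped Manifold ContDiff Topology ComplexConjugate
open Bundle Set Filter
open Literature.NumberTheory.Transcendental

namespace Literature.Geometry.Kaehler

namespace Zucker

/-! ### The period isomorphism -/

/-- The complex coordinate `u = x₀ + i x₁` of `ℝ⁴`. [folklore] -/
def uC (x : Fin (2 * 2) → ℝ) : ℂ := ⟨x 0, x 1⟩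

/-- The complex coordinate `v = x₂ + i x₃` of `ℝ⁴`. [folklore] -/
def vC (x : Fin (2 * 2) → ℝ) : ℂ := ⟨x 2, x 3⟩

/-- `uC` is additive. [folklore] -/
theorem uC_add (x y : Fin (2 * 2) → ℝ) : uC (x + y) = uC x + uC y := Complex.ext rfl rfl
/-- `vC` is additive. [folklore] -/
theorem vC_add (x y : Fin (2 * 2) → ℝ) : vC (x + y) = vC x + vC y := Complex.ext rfl rfl
/-- `uC` is homogeneous. [folklore] -/
theorem uC_smul (r : ℝ) (x : Fin (2 * 2) → ℝ) : uC (r • x) = (r : ℂ) * uC x :=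
  Complex.ext (by simp [uC]) (by simp [uC])
/-- `vC` is homogeneous. [folklore] -/
theorem vC_smul (r : ℝ) (x : Fin (2 * 2) → ℝ) : vC (r • x) = (r : ℂ) * vC x :=
  Complex.ext (by simp [vC]) (by simp [vC])

/-- Zucker's period map as a function: `x ↦ (u + a v, ū + (ā + 1) v̄)`, i.e.
`x₀ v₁ + x₁ Jv₁ + x₂ v₂ + x₃ Jv₂` for `v₁ = (1, 1)`, `v₂ = (a, ā + 1)`, `J(z, w) = (iz, -iw)`.
[cite: Zucker1977, Appendix B] -/
def phiFun (a : ℂ) (x : Fin (2 * 2) → ℝ) : Fin 2 → ℂ :=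
  ![uC x + a * vC x, conj (uC x) + (conj a + 1) * conj (vC x)]

/-- First coordinate of the period map. [folklore] -/
theorem phiFun_apply_zero (a : ℂ) (x : Fin (2 * 2) → ℝ) : phiFun a x 0 = uC x + a * vC x := rfl

/-- Second coordinate of the period map. [folklore] -/
theorem phiFun_apply_one (a : ℂ) (x : Fin (2 * 2) → ℝ) :
    phiFun a x 1 = conj (uC x) + (conj a + 1) * conj (vC x) := rfl

/-- The inverse of the period map: `v = w̄ - z`, `u = z - a v`. [folklore] -/
def phiInv (a : ℂ) (f : Fin 2 → ℂ) : Fin (2 * 2) → ℝ :=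
  ![(f 0 - a * (conj (f 1) - f 0)).re, (f 0 - a * (conj (f 1) - f 0)).im,
    (conj (f 1) - f 0).re, (conj (f 1) - f 0).im]

/-- `u`-coordinate of the inverse. [folklore] -/
theorem uC_phiInv (a : ℂ) (f : Fin 2 → ℂ) : uC (phiInv a f) = f 0 - a * (conj (f 1) - f 0) :=
  Complex.ext rfl rfl

/-- `v`-coordinate of the inverse. [folklore] -/
theorem vC_phiInv (a : ℂ) (f : Fin 2 → ℂ) : vC (phiInv a f) = conj (f 1) - f 0 :=
  Complex.ext rfl rfl

/-- The period map as a real-linear map. [cite: Zucker1977, Appendix B] -/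
def phiLin (a : ℂ) : (Fin (2 * 2) → ℝ) →ₗ[ℝ] (Fin 2 → ℂ) where
  toFun := phiFun a
  map_add' x y := by
    funext i
    fin_cases i
    · show phiFun a (x + y) 0 = phiFun a x 0 + phiFun a y 0
      rw [phiFun_apply_zero, phiFun_apply_zero, phiFun_apply_zero, uC_add, vC_add]
      ring
    · show phiFun a (x + y) 1 = phiFun a x 1 + phiFun a y 1
      rw [phiFun_apply_one, phiFun_apply_one, phiFun_apply_one, uC_add, vC_add, map_add, map_add]
      ring
  map_smul' r x := by
    funext i
    fin_cases i
    · show phiFun a (r • x) 0 = r • phiFun a x 0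
      rw [phiFun_apply_zero, phiFun_apply_zero, uC_smul, vC_smul, Complex.real_smul]
      ring
    · show phiFun a (r • x) 1 = r • phiFun a x 1
      rw [phiFun_apply_one, phiFun_apply_one, uC_smul, vC_smul, Complex.real_smul, map_mul, map_mul,
        Complex.conj_ofReal]
      ring

/-- The period map is a real-linear isomorphism `ℝ⁴ ≃ ℂ²` (explicit inverse `phiInv`).
[cite: Zucker1977, Appendix B] -/
def phiEquiv (a : ℂ) : (Fin (2 * 2) → ℝ) ≃ₗ[ℝ] (Fin 2 → ℂ) :=
  { phiLin a with
    invFun := phiInv a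
    left_inv := fun x ↦ by
      have hu : uC (phiInv a (phiFun a x)) = uC x := by
        rw [uC_phiInv, phiFun_apply_zero, phiFun_apply_one]
        simp only [map_add, map_mul, Complex.conj_conj, map_one]
        ring
      have hv : vC (phiInv a (phiFun a x)) = vC x := by
        rw [vC_phiInv, phiFun_apply_zero, phiFun_apply_one]
        simp only [map_add, map_mul, Complex.conj_conj, map_one]
        ring
      funext i
      fin_cases i
      · exact congrArg Complex.re hu
      · exact congrArg Complex.im hu
      · exact congrArg Complex.re hv
      · exact congrArg Complex.im hv
    right_inv := fun f ↦ by
      change phiFun a (phiInv a f) = f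
      funext i
      fin_cases i
      · show phiFun a (phiInv a f) 0 = f 0
        rw [phiFun_apply_zero, uC_phiInv, vC_phiInv]
        ring
      · show phiFun a (phiInv a f) 1 = f 1
        rw [phiFun_apply_one, uC_phiInv, vC_phiInv]
        simp only [map_sub, map_mul, Complex.conj_conj]
        ring }

/-- **Zucker's period isomorphism** `Φ_a : ℝ⁴ ≃ ℂ²` (continuous: finite dimension), the columns
being the lattice basis `v₁ = (1, 1)`, `Jv₁ = (i, -i)`, `v₂ = (a, ā + 1)`, `Jv₂ = (ia, -i(ā + 1))`
of the `J`-stable lattice `L_a`. [cite: Zucker1977, Appendix B] -/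
def phi (a : ℂ) : (Fin (2 * 2) → ℝ) ≃L[ℝ] (Fin 2 → ℂ) :=
  (phiEquiv a).toContinuousLinearEquiv

/-- First coordinate of `Φ_a x`: `z = u + a v`. [folklore] -/
theorem phi_apply_zero (a : ℂ) (x : Fin (2 * 2) → ℝ) : phi a x 0 = uC x + a * vC x := rfl

/-- Second coordinate of `Φ_a x`: `w = ū + (ā + 1) v̄`. [folklore] -/
theorem phi_apply_one (a : ℂ) (x : Fin (2 * 2) → ℝ) :
    phi a x 1 = conj (uC x) + (conj a + 1) * conj (vC x) := rfl

/-- **Zucker's `J`-torus** `T_a = ℂ²/L_a`, as a complex torus of the tree: a compact connected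
Kähler surface homeomorphic to `(S¹)⁴` (all instances inherited from `ComplexTorus`).
[cite: Zucker1977, Appendix B] -/
abbrev Torus (a : ℂ) : Type := ComplexTorus (phi a)

/-! ### The automorphism `J` -/

/-- `(J f) 0 = i f 0` (from `Zucker.J_apply`). [folklore] -/
theorem J_apply_zero (f : Fin 2 → ℂ) : J f 0 = Complex.I * f 0 := by simp
/-- `(J f) 1 = -i f 1` (from `Zucker.J_apply`). [folklore] -/
theorem J_apply_one (f : Fin 2 → ℂ) : J f 1 = -(Complex.I * f 1) := by simp

/-- The matrix of `J` in the lattice basis `(v₁, Jv₁, v₂, Jv₂)`: `e₀ ↦ e₁ ↦ -e₀`,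
`e₂ ↦ e₃ ↦ -e₂` (`J² = -1`). [cite: Zucker1977, Appendix B] -/
def A : Matrix (Fin (2 * 2)) (Fin (2 * 2)) ℤ :=
  !![0, -1, 0, 0; 1, 0, 0, 0; 0, 0, 0, -1; 0, 0, 1, 0]

/-- `A` acts on real coordinates by `(x₀, x₁, x₂, x₃) ↦ (-x₁, x₀, -x₃, x₂)`. [folklore] -/
theorem A_mulVec (x : Fin (2 * 2) → ℝ) :
    (A.map (Int.cast : ℤ → ℝ)).mulVec x = ![-x 1, x 0, -x 3, x 2] := by
  funext i
  fin_cases i <;> simp [A, Matrix.mulVec, dotProduct, Fin.sum_univ_four]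

/-- `u`-coordinate of `A x`: `i u`. [folklore] -/
theorem uC_A (x : Fin (2 * 2) → ℝ) : uC ![-x 1, x 0, -x 3, x 2] = Complex.I * uC x :=
  Complex.ext (by simp [uC]) (by simp [uC])

/-- `v`-coordinate of `A x`: `i v`. [folklore] -/
theorem vC_A (x : Fin (2 * 2) → ℝ) : vC ![-x 1, x 0, -x 3, x 2] = Complex.I * vC x :=
  Complex.ext (by simp [vC]) (by simp [vC])

/-- **`JL = L`**: the period map intertwines the integer matrix `A` with `J`,
`Φ_a (A x) = J (Φ_a x)`. [cite: Zucker1977, Appendix B] -/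
theorem phi_mulVec_A (a : ℂ) (x : Fin (2 * 2) → ℝ) :
    phi a ((A.map (Int.cast : ℤ → ℝ)).mulVec x) = J (phi a x) := by
  rw [A_mulVec]
  funext i
  fin_cases i
  · show phi a _ 0 = J (phi a x) 0
    rw [J_apply_zero, phi_apply_zero, phi_apply_zero, uC_A, vC_A]
    ring
  · show phi a _ 1 = J (phi a x) 1
    rw [J_apply_one, phi_apply_one, phi_apply_one, uC_A, vC_A]
    simp only [map_mul, Complex.conj_I]
    ring

/-- **Zucker's automorphism `J` of the torus** `T_a`, induced by `J` on `V` (`JL = L`): the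
homomorphism `mapMatrix A`. [cite: Zucker1977, Appendix B] -/
def JT (a : ℂ) : Torus a → Torus a := ComplexTorus.mapMatrix (phi a) (phi a) A

/-- **`J` is a holomorphic self-map of the torus** (its analytic representation `J` is
`ℂ`-linear). [cite: Zucker1977, Appendix B] -/
theorem contMDiff_JT (a : ℂ) : ContMDiff 𝓘(ℂ, Fin 2 → ℂ) 𝓘(ℂ, Fin 2 → ℂ) ω (JT a) :=
  ComplexTorus.contMDiff_mapMatrix J (phi_mulVec_A a)

/-- `J` is a real `C^∞` self-map of the torus. [folklore] -/
theorem contMDiff_real_JT (a : ℂ) : ContMDiff 𝓘(ℝ, Fin 2 → ℂ) 𝓘(ℝ, Fin 2 → ℂ) ∞ (JT a) :=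
  ComplexTorus.contMDiff_real_mapMatrix A

/-- The real analytic representation of `J` on the torus is `J`. [cite: Zucker1977, Appendix B] -/
theorem realRep_A (a : ℂ) :
    ComplexTorus.realRep (phi a) (phi a) A = (J : (Fin 2 → ℂ) →L[ℂ] (Fin 2 → ℂ)).restrictScalars ℝ := by
  ext1 f
  have h := ComplexTorus.realRep_apply (Φ := phi a) (Φ' := phi a) A ((phi a).symm f)
  rw [ContinuousLinearEquiv.apply_symm_apply] at h
  rw [h, phi_mulVec_A, ContinuousLinearEquiv.apply_symm_apply]
  rfl

/-! ### Mumford's form `ω = dz ∧ dw̄` (the tree's `Zucker.omega`) -/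

/-- **Evaluation of Zucker's form**: `ω(v, w) = v₀ w̄₁ - w₀ v̄₁` for `ω = Zucker.omega` of
`ComplexTorusZuckerJ.lean` (the alternatisation of `(v, w) ↦ v₀ w̄₁`). [cite: Zucker1977, Appendix B Lemma] -/
theorem omega_apply (v : Fin 2 → Fin 2 → ℂ) :
    omega v = v 0 0 * conj (v 1 1) - v 1 0 * conj (v 0 1) := by
  simp only [omega, ContinuousMultilinearMap.alternatization_apply_apply]
  have huniv : (Finset.univ : Finset (Equiv.Perm (Fin 2))) = {1, Equiv.swap 0 1} := by decide
  rw [huniv, Finset.sum_pair (by decide)]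
  simp [omegaAux_apply, Equiv.Perm.sign_swap', Units.smul_def, sub_eq_add_neg]

/-- **`ω` has type `(1, 1)`**: `ω(e^{iθ}v, e^{iθ}w) = ω(v, w)` (`dz` has weight `1`, `dw̄`
weight `-1`). [cite: Zucker1977, Appendix B Lemma] -/
theorem isConstOfType_omega : ComplexTorus.IsConstOfType (k := 2) 1 1 omega := by
  refine ⟨rfl, fun θ v ↦ ?_⟩
  rw [omega_apply, omega_apply]
  have h : (starRingEnd ℂ) (Complex.exp (θ * Complex.I)) * Complex.exp (θ * Complex.I) = 1 := by
    rw [← Complex.exp_conj, ← Complex.exp_add]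
    simp [Complex.conj_ofReal]
  simp only [Pi.smul_apply, smul_eq_mul, map_mul, Nat.cast_one, sub_self, Int.cast_zero, zero_mul,
    Complex.exp_zero, one_mul]
  linear_combination (v 0 0 * conj (v 1 1) - v 1 0 * conj (v 0 1)) * h

/-- **`J^* ω = -ω`** (`J^* dz = i dz`, `J^* dw̄ = i dw̄`; Zucker: "`J^*ω = i^{2n} ω = (-1)ⁿ ω`",
`n = 1`). [cite: Zucker1977, Appendix B Theorem] -/
theorem omega_comp_J :
    omega.compContinuousLinearMap ((J : (Fin 2 → ℂ) →L[ℂ] (Fin 2 → ℂ)).restrictScalars ℝ) = -omega := by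
  ext v
  rw [ContinuousAlternatingMap.compContinuousLinearMap_apply, ContinuousAlternatingMap.neg_apply,
    omega_apply, omega_apply]
  simp only [Function.comp_apply, ContinuousLinearMap.coe_restrictScalars', J_apply_zero, J_apply_one,
    map_neg, map_mul, Complex.conj_I]
  linear_combination (v 0 0 * conj (v 1 1) - v 1 0 * conj (v 0 1)) * Complex.I_mul_I

/-- `v₁ = Φ_a e₀ = (1, 1)`. [cite: Zucker1977, Appendix B] -/
theorem phi_single_zero (a : ℂ) : phi a (Pi.single 0 1) = ![1, 1] := by
  have hu : uC (Pi.single (0 : Fin (2 * 2)) (1 : ℝ)) = 1 := Complex.ext (by simp [uC]) (by simp [uC])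
  have hv : vC (Pi.single (0 : Fin (2 * 2)) (1 : ℝ)) = 0 := Complex.ext (by simp [vC]) (by simp [vC])
  funext i
  fin_cases i
  · show phi a _ 0 = 1
    rw [phi_apply_zero, hu, hv]
    ring
  · show phi a _ 1 = 1
    rw [phi_apply_one, hu, hv]
    simp

/-- `Jv₁ = Φ_a e₁ = (i, -i)`. [cite: Zucker1977, Appendix B] -/
theorem phi_single_one (a : ℂ) : phi a (Pi.single 1 1) = ![Complex.I, -Complex.I] := by
  have hu : uC (Pi.single (1 : Fin (2 * 2)) (1 : ℝ)) = Complex.I :=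
    Complex.ext (by simp [uC]) (by simp [uC])
  have hv : vC (Pi.single (1 : Fin (2 * 2)) (1 : ℝ)) = 0 := Complex.ext (by simp [vC]) (by simp [vC])
  funext i
  fin_cases i
  · show phi a _ 0 = Complex.I
    rw [phi_apply_zero, hu, hv]
    ring
  · show phi a _ 1 = -Complex.I
    rw [phi_apply_one, hu, hv]
    simp [Complex.conj_I]

/-- `v₂ = Φ_a e₂ = (a, ā + 1)`. [cite: Zucker1977, Appendix B] -/
theorem phi_single_two (a : ℂ) : phi a (Pi.single 2 1) = ![a, conj a + 1] := by
  have hu : uC (Pi.single (2 : Fin (2 * 2)) (1 : ℝ)) = 0 := Complex.ext (by simp [uC]) (by simp [uC])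
  have hv : vC (Pi.single (2 : Fin (2 * 2)) (1 : ℝ)) = 1 := Complex.ext (by simp [vC]) (by simp [vC])
  funext i
  fin_cases i
  · show phi a _ 0 = a
    rw [phi_apply_zero, hu, hv]
    ring
  · show phi a _ 1 = conj a + 1
    rw [phi_apply_one, hu, hv]
    simp

/-- `Jv₂ = Φ_a e₃ = (ia, -i(ā + 1))`. [cite: Zucker1977, Appendix B] -/
theorem phi_single_three (a : ℂ) :
    phi a (Pi.single 3 1) = ![Complex.I * a, -(Complex.I * (conj a + 1))] := by
  have hu : uC (Pi.single (3 : Fin (2 * 2)) (1 : ℝ)) = 0 := Complex.ext (by simp [uC]) (by simp [uC])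
  have hv : vC (Pi.single (3 : Fin (2 * 2)) (1 : ℝ)) = Complex.I :=
    Complex.ext (by simp [vC]) (by simp [vC])
  funext i
  fin_cases i
  · show phi a _ 0 = Complex.I * a
    rw [phi_apply_zero, hu, hv]
    ring
  · show phi a _ 1 = -(Complex.I * (conj a + 1))
    rw [phi_apply_one, hu, hv]
    simp [Complex.conj_I]
    ring

/-- **Mumford's lemma (the periods of `ω`)**: on pairs of lattice basis vectors the values of
`ω = dz ∧ dw̄` are `ω(v₁, Jv₁) = 0`, `ω(v₁, v₂) = 1`, `ω(v₁, Jv₂) = i`, `ω(Jv₁, v₂) = i`,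
`ω(Jv₁, Jv₂) = -1`, `ω(v₂, Jv₂) = 0` — "the numbers obtained are all of the form `iᵏ` or `0`",
so that `ξ = Re ω` and `η = Im ω` have integral periods. [cite: Zucker1977, Appendix B Lemma] -/
theorem omega_phi_basis (a : ℂ) :
    omega ![phi a (Pi.single 0 1), phi a (Pi.single 1 1)] = 0 ∧
    omega ![phi a (Pi.single 0 1), phi a (Pi.single 2 1)] = 1 ∧
    omega ![phi a (Pi.single 0 1), phi a (Pi.single 3 1)] = Complex.I ∧
    omega ![phi a (Pi.single 1 1), phi a (Pi.single 2 1)] = Complex.I ∧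
    omega ![phi a (Pi.single 1 1), phi a (Pi.single 3 1)] = -1 ∧
    omega ![phi a (Pi.single 2 1), phi a (Pi.single 3 1)] = 0 := by
  rw [phi_single_zero, phi_single_one, phi_single_two, phi_single_three]
  refine ⟨?_, ?_, ?_, ?_, ?_, ?_⟩
  · simp [omega_apply]
  · simp [omega_apply]
  · simp [omega_apply]
    ring
  · simp [omega_apply]
    ring
  · simp [omega_apply]
    ring_nf
    simp [Complex.I_sq]
  · simp [omega_apply]
    ring

/-! ### The class `[ω]` in `H^{1,1}(T_a)` -/

/-- **The class of Mumford's form**, `[constForm ω] ∈ H²_dR(T_a; ℂ)`. [cite: Zucker1977, Appendix B Lemma] -/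
def omegaClass (a : ℂ) : complexDeRhamCohomology (Fin 2 → ℂ) (Torus a) 2 :=
  ComplexTorus.cconstClass (phi a) omega

/-- **`[ω]` is a class of type `(1, 1)`**: `[ω] ∈ H^{1,1}(T_a)`. [cite: Zucker1977, Appendix B Lemma] -/
theorem omegaClass_mem_hodgePQ (a : ℂ) :
    omegaClass a ∈ hodgePQ (Fin 2 → ℂ) (Torus a) 2 1 1 :=
  ComplexTorus.cconstClass_mem_hodgePQ (phi a) isConstOfType_omega

/-- `[ω] ≠ 0` (invariant classes are independent; `ω(v₁, v₂) = 1`). [cite: Zucker1977, Appendix B] -/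
theorem omegaClass_ne_zero (a : ℂ) : omegaClass a ≠ 0 := by
  intro h
  have h1 : omega = 0 := by
    have h2 := congrArg (ComplexTorus.cavgClass (phi a)) h
    rwa [omegaClass, ComplexTorus.cavgClass_cconstClass, LinearMap.map_zero] at h2
  have h3 := (omega_phi_basis a).2.1
  rw [h1] at h3
  simp at h3

/-- **`J^* [ω] = -[ω]`** on `H²_dR(T_a; ℂ)` (pull-back along the holomorphic automorphism `J` of
the torus; Zucker: "`J^* ξ = -ξ` and `J^* η = -η`"). [cite: Zucker1977, Appendix B Theorem] -/
theorem map_JT_omegaClass (a : ℂ) :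
    complexDeRhamCohomology.map (Fin 2 → ℂ) (contMDiff_real_JT a) 2 (omegaClass a) = -omegaClass a := by
  rw [omegaClass, ComplexTorus.cconstClass_apply, complexDeRhamCohomology.map_mk, ← LinearMap.map_neg,
    complexDeRhamCohomology.mk_eq_mk_iff, Submodule.coe_neg]
  have h : (ComplexTorus.constForm (phi a) omega).pullback 𝓘(ℝ, Fin 2 → ℂ) (JT a) =
      ComplexTorus.constForm (phi a) (-omega) := by
    rw [JT, ComplexTorus.pullback_constForm_mapMatrix, realRep_A, omega_comp_J]
  change (ComplexTorus.constForm (phi a) omega).pullback 𝓘(ℝ, Fin 2 → ℂ) (JT a) -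
    -ComplexTorus.constForm (phi a) omega ∈ _
  have h0 : (ComplexTorus.constForm (phi a) omega).pullback 𝓘(ℝ, Fin 2 → ℂ) (JT a) -
      -ComplexTorus.constForm (phi a) omega = 0 := by
    rw [h]
    change -ComplexTorus.constForm (phi a) omega - -ComplexTorus.constForm (phi a) omega = 0
    exact sub_self _
  rw [h0]
  exact Submodule.zero_mem _

end Zucker

end Literature.Geometry.Kaehler
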